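import Summits.BirchSwinnertonDyer.BirchSwinnertonDyer.Theses.ShadowIsolation
import Summits.BirchSwinnertonDyer.BirchSwinnertonDyer.Theorems.ShadowIsolationPrimeSupplyIrreducible
import Summits.BirchSwinnertonDyer.BirchSwinnertonDyer.Theorems.ShadowIsolationShaUnboundedOfCorank
import Literature.Barriers.BirchSwinnertonDyer.RankNotSumOfLocalInvariantsF4TwistPoints2993

/-!
# BirchSwinnertonDyer / ShadowIsolation — crux `PhantomShadow` (stmt-BirchSwinnertonDyer-15787):
# placement lemmas (redirect strategist r1, 2026-08-17) — the used sector is Ш-cotorsion, and no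
# rank- or Selmer-corank-driven shadow principle survives the sibling crux

Negative-lane helper lemmas (no route statement is asserted positively; no definition is introduced; every
statement is inlined). `A(W,p,n)` denotes the conclusion of `PhantomShadow` at depth `n` (verbatim the predicate
negated in `IsolationOfAccidentalZeros`); `Isolation` = `IsolationOfAccidentalZeros` (stmt-BirchSwinnertonDyer-15786).

* `PhantomShadowNegative.phantomShadow_of_shaCotorsion_of_finiteSector` — the crux FOLLOWS from
  (i) Ш[p^∞]-cotorsion on its own sector (`shaCorank W p = 0` for `W` globally minimal elliptic, `p ≥ 5` good
  ordinary, `E[p]` irreducible) together with (ii) its FINITE sector (corank `0` and an element of exact order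
  `pⁿ` ⇒ `A(W,p,n)`): under (i) the divisible sector is vacuous. Sector (ii) is consumed by nothing in the route.
* `PhantomShadowNegative.shaCotorsion_iff_divisibleSector_of_isolation` — GIVEN `Isolation`, the divisible
  sector of the crux (`shaCorank W p ≠ 0 ⇒ ∀ n ≥ 1, A(W,p,n)`, the only sector the route's deciding theorem uses)
  is EQUIVALENT to Ш[p^∞]-cotorsion on that sector — the open core named by
  `Literature.Barriers.BirchSwinnertonDyer.SelmerRankBarrierNarrow`, i.e. route SelmerRank's bare crux
  `SelmerRankShaPFinite` (stmt-BirchSwinnertonDyer-0132) restricted to irreducible good ordinary `p ≥ 5`.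
* `PhantomShadowNegative.not_rankShadow_of_isolation` — `Isolation` REFUTES the rank-driven principle
  "Mordell–Weil rank `≥ 2` ⇒ `A(W,p,n)` at every depth": witnessed by the tree's PROVED rank-two curve
  `480a1^(−2993)` (`Literature.Barriers.BirchSwinnertonDyer.DokchitserDokchitser2011.two_le_mordellWeilRank_neg2993`),
  a global minimal model of it (`hasGlobalMinimalModel_rat_holds`, rank invariant under the change of variables)
  and the route's proved prime supply `primeSupplyIrreducible_proof`, at depth `max n₀ 1`.
* `PhantomShadowNegative.not_selmerShadow_of_isolation` — hence `Isolation` refutes, for every `k ≤ 2`, the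
  Selmer-driven principle "`corank_{ℤ_p} Sel_{p^∞}(E/ℚ) ≥ k` ⇒ `A(W,p,n)` at every depth" (Greenberg's proved
  identity `corank Sel = rank + corank Ш`). A positive Ш-corank enters every transported-Selmer /
  Kato-repulsion / reciprocity-law argument only through `corank Sel ≥ 1` (`≥ 2` in even sign), so such an
  argument for the divisible sector proves one of these principles verbatim and kills the route's other crux:
  a route-compatible proof must separate `T_pШ(E)` from `E(ℚ) ⊗ ℤ_p`.
Companion work file with the packaged `def`s and the full lattice: `Cruxes/PhantomShadow/StrategistR1.lean`;
census: `Cruxes/PhantomShadow/STRATEGY-CENSUS.md` (r1). [folklore]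
-/

set_option linter.dupNamespace false

namespace Summit.BirchSwinnertonDyer.BirchSwinnertonDyer.Theorems

open Summit.BirchSwinnertonDyer.BirchSwinnertonDyer.Theses.ShadowIsolation
open Literature.NumberTheory.EllipticCurves.ModularForms

/-- **`PhantomShadow` ⇐ Ш-cotorsion (its sector) ∧ its finite sector.** If `shaCorank W p = 0` for every
globally minimal elliptic `W/ℚ` and every good ordinary `p ≥ 5` with irreducible `E[p]`, the divisible sector
of the crux is vacuous and the crux reduces to its finite sector (corank `0`, an element of exact order `pⁿ` ⇒
an accidental zero at depth `n`), which the route never uses. [folklore] -/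
theorem PhantomShadowNegative.phantomShadow_of_shaCotorsion_of_finiteSector
    (hSha : ∀ (W : WeierstrassCurve ℚ) [W.IsElliptic] [W.IsGloballyMinimal] (p : ℕ) [Fact p.Prime], 5 ≤ p →
      W.HasGoodReductionAtPrime p → ¬ (p : ℤ) ∣ W.frobeniusTrace p → W.HasIrreducibleModPGaloisRep p →
      W.shaCorank p = 0)
    (hFin : ∀ (W : WeierstrassCurve ℚ) [W.IsElliptic] [W.IsGloballyMinimal] (p : ℕ) [Fact p.Prime], 5 ≤ p →
      W.HasGoodReductionAtPrime p → ¬ (p : ℤ) ∣ W.frobeniusTrace p → W.HasIrreducibleModPGaloisRep p →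
      W.shaCorank p = 0 → ∀ n : ℕ, 1 ≤ n → (∃ σ : W.sha, addOrderOf σ = p ^ n) →
      ∃ (M : ℕ) (_ : NeZero (W.conductorNorm ℤ * M))
        (g : CuspForm (CongruenceSubgroup.Gamma0 (W.conductorNorm ℤ * M)) 2) (R : Subring ℂ)
        (φ : R →+* ZMod (p ^ n))
        (hR : ∀ ℓ : ℕ, ℓ.Prime → ¬ ℓ ∣ W.conductorNorm ℤ * M → heckeEigenvalue g ℓ ∈ R),
        Squarefree M ∧ Nat.Coprime M (p * W.conductorNorm ℤ) ∧ IsNewform0 g ∧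
        (∃ m : ℕ, (UpperHalfPlane.qExpansion 1 ⇑g).coeff m ≠ ((W.LFunction m : ℤ) : ℂ)) ∧
        cuspHeckeOperatorₗ (CongruenceSubgroup.Gamma0 (W.conductorNorm ℤ * M)) 2
          (slToGLPos ModularGroup.S * diagGL ((W.conductorNorm ℤ * M : ℕ) : ℚ) 1
            (Nat.cast_pos.mpr (NeZero.pos (W.conductorNorm ℤ * M))) one_pos) g = -g ∧
        (∀ (ℓ : ℕ) (hℓ : ℓ.Prime) (hℓL : ¬ ℓ ∣ W.conductorNorm ℤ * M),
          φ ⟨heckeEigenvalue g ℓ, hR ℓ hℓ hℓL⟩ = ((W.frobeniusTrace ℓ : ℤ) : ZMod (p ^ n))) ∧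
        ∃ Λ : ℂ → ℂ, Differentiable ℂ Λ ∧
          (∀ s : ℂ, 2 < s.re → Λ s = LSeries (fun m ↦ (UpperHalfPlane.qExpansion 1 ⇑g).coeff m) s) ∧
          Λ 1 = 0) :
    PhantomShadow := by
  intro W _ _ p _ h5 hg ho hi n hn hσ
  exact hFin W p h5 hg ho hi (hSha W p h5 hg ho hi) n hn hσ

/-- **Given `Isolation`, the divisible sector of `PhantomShadow` is EQUIVALENT to Ш-cotorsion on its sector.**
(→) contrapositive at depth `max n₀ 1`; (←) ex falso. The divisible sector (`shaCorank W p ≠ 0 ⇒` accidental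
zeros at every depth `n ≥ 1`) is the only part of the crux the route's deciding theorem consumes (it reaches it
through the landed support `shaUnboundedOfCorank_proof`). Greenberg 1999 §1 for the corank bookkeeping.
[cite: GreenbergLNM1716, §1] -/
theorem PhantomShadowNegative.shaCotorsion_iff_divisibleSector_of_isolation (hI : IsolationOfAccidentalZeros) :
    (∀ (W : WeierstrassCurve ℚ) [W.IsElliptic] [W.IsGloballyMinimal] (p : ℕ) [Fact p.Prime], 5 ≤ p →
      W.HasGoodReductionAtPrime p → ¬ (p : ℤ) ∣ W.frobeniusTrace p → W.HasIrreducibleModPGaloisRep p →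
      W.shaCorank p = 0) ↔
    (∀ (W : WeierstrassCurve ℚ) [W.IsElliptic] [W.IsGloballyMinimal] (p : ℕ) [Fact p.Prime], 5 ≤ p →
      W.HasGoodReductionAtPrime p → ¬ (p : ℤ) ∣ W.frobeniusTrace p → W.HasIrreducibleModPGaloisRep p →
      W.shaCorank p ≠ 0 → ∀ n : ℕ, 1 ≤ n →
      ∃ (M : ℕ) (_ : NeZero (W.conductorNorm ℤ * M))
        (g : CuspForm (CongruenceSubgroup.Gamma0 (W.conductorNorm ℤ * M)) 2) (R : Subring ℂ)
        (φ : R →+* ZMod (p ^ n))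
        (hR : ∀ ℓ : ℕ, ℓ.Prime → ¬ ℓ ∣ W.conductorNorm ℤ * M → heckeEigenvalue g ℓ ∈ R),
        Squarefree M ∧ Nat.Coprime M (p * W.conductorNorm ℤ) ∧ IsNewform0 g ∧
        (∃ m : ℕ, (UpperHalfPlane.qExpansion 1 ⇑g).coeff m ≠ ((W.LFunction m : ℤ) : ℂ)) ∧
        cuspHeckeOperatorₗ (CongruenceSubgroup.Gamma0 (W.conductorNorm ℤ * M)) 2
          (slToGLPos ModularGroup.S * diagGL ((W.conductorNorm ℤ * M : ℕ) : ℚ) 1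
            (Nat.cast_pos.mpr (NeZero.pos (W.conductorNorm ℤ * M))) one_pos) g = -g ∧
        (∀ (ℓ : ℕ) (hℓ : ℓ.Prime) (hℓL : ¬ ℓ ∣ W.conductorNorm ℤ * M),
          φ ⟨heckeEigenvalue g ℓ, hR ℓ hℓ hℓL⟩ = ((W.frobeniusTrace ℓ : ℤ) : ZMod (p ^ n))) ∧
        ∃ Λ : ℂ → ℂ, Differentiable ℂ Λ ∧
          (∀ s : ℂ, 2 < s.re → Λ s = LSeries (fun m ↦ (UpperHalfPlane.qExpansion 1 ⇑g).coeff m) s) ∧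
          Λ 1 = 0) := by
  constructor
  · intro hSha W _ _ p _ h5 hg ho hi hne _ _
    exact absurd (hSha W p h5 hg ho hi) hne
  · intro hDiv W _ _ p _ h5 hg ho hi
    by_contra hne
    obtain ⟨n₀, hn₀⟩ := hI W p h5 hg ho hi
    exact hn₀ (max n₀ 1) (le_max_left _ _) (hDiv W p h5 hg ho hi hne (max n₀ 1) (le_max_right _ _))

/-- **`Isolation` refutes the rank-driven shadow principle** "Mordell–Weil rank `≥ 2` ⇒ an accidental zero at
every depth `n ≥ 1`": instantiate at a global minimal model `C • E` of the rank-two curve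
`E = 480a1^(−2993) : y² = x³ + 2993x² − 6·2993²x` (Dokchitser–Dokchitser 2011; tree
`two_le_mordellWeilRank_neg2993`, rank invariant under `C` by AEC III.3.1(b)) and at the prime of
`primeSupplyIrreducible_proof`, at depth `max n₀ 1`. [cite: DokchitserDokchitser2011RankModN, proof of Thm. 2] -/
theorem PhantomShadowNegative.not_rankShadow_of_isolation (hI : IsolationOfAccidentalZeros) :
    ¬ ∀ (W : WeierstrassCurve ℚ) [W.IsElliptic] [W.IsGloballyMinimal] (p : ℕ) [Fact p.Prime], 5 ≤ p →
      W.HasGoodReductionAtPrime p → ¬ (p : ℤ) ∣ W.frobeniusTrace p → W.HasIrreducibleModPGaloisRep p →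
      2 ≤ W.mordellWeilRank → ∀ n : ℕ, 1 ≤ n →
      ∃ (M : ℕ) (_ : NeZero (W.conductorNorm ℤ * M))
        (g : CuspForm (CongruenceSubgroup.Gamma0 (W.conductorNorm ℤ * M)) 2) (R : Subring ℂ)
        (φ : R →+* ZMod (p ^ n))
        (hR : ∀ ℓ : ℕ, ℓ.Prime → ¬ ℓ ∣ W.conductorNorm ℤ * M → heckeEigenvalue g ℓ ∈ R),
        Squarefree M ∧ Nat.Coprime M (p * W.conductorNorm ℤ) ∧ IsNewform0 g ∧
        (∃ m : ℕ, (UpperHalfPlane.qExpansion 1 ⇑g).coeff m ≠ ((W.LFunction m : ℤ) : ℂ)) ∧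
        cuspHeckeOperatorₗ (CongruenceSubgroup.Gamma0 (W.conductorNorm ℤ * M)) 2
          (slToGLPos ModularGroup.S * diagGL ((W.conductorNorm ℤ * M : ℕ) : ℚ) 1
            (Nat.cast_pos.mpr (NeZero.pos (W.conductorNorm ℤ * M))) one_pos) g = -g ∧
        (∀ (ℓ : ℕ) (hℓ : ℓ.Prime) (hℓL : ¬ ℓ ∣ W.conductorNorm ℤ * M),
          φ ⟨heckeEigenvalue g ℓ, hR ℓ hℓ hℓL⟩ = ((W.frobeniusTrace ℓ : ℤ) : ZMod (p ^ n))) ∧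
        ∃ Λ : ℂ → ℂ, Differentiable ℂ Λ ∧
          (∀ s : ℂ, 2 < s.re → Λ s = LSeries (fun m ↦ (UpperHalfPlane.qExpansion 1 ⇑g).coeff m) s) ∧
          Λ 1 = 0 := by
  intro hR
  classical
  haveI hE : (Literature.Barriers.BirchSwinnertonDyer.curve480a1.quadraticTwist (-2993)).IsElliptic :=
    Literature.Barriers.BirchSwinnertonDyer.DokchitserDokchitser2011.isElliptic_twist (by norm_num)
  obtain ⟨C, hC⟩ := WeierstrassCurve.hasGlobalMinimalModel_rat_holds
    (Literature.Barriers.BirchSwinnertonDyer.curve480a1.quadraticTwist (-2993))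
  obtain ⟨p, hp, h5, hgood, hord, hirr⟩ := primeSupplyIrreducible_proof
    (C • Literature.Barriers.BirchSwinnertonDyer.curve480a1.quadraticTwist (-2993))
  obtain ⟨n₀, hn₀⟩ :=
    hI (C • Literature.Barriers.BirchSwinnertonDyer.curve480a1.quadraticTwist (-2993)) p h5 hgood hord hirr
  have hrank : 2 ≤ (C • Literature.Barriers.BirchSwinnertonDyer.curve480a1.quadraticTwist (-2993)).mordellWeilRank := by
    have h : (C • Literature.Barriers.BirchSwinnertonDyer.curve480a1.quadraticTwist (-2993)).mordellWeilRank =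
        (Literature.Barriers.BirchSwinnertonDyer.curve480a1.quadraticTwist (-2993)).mordellWeilRank :=
      @WeierstrassCurve.VariableChange.finrank_point_variableChange ℚ _
        (Literature.Barriers.BirchSwinnertonDyer.curve480a1.quadraticTwist (-2993)) C (Classical.decEq ℚ)
    rw [h]
    exact Literature.Barriers.BirchSwinnertonDyer.DokchitserDokchitser2011.two_le_mordellWeilRank_neg2993
  exact hn₀ (max n₀ 1) (le_max_left _ _)
    (hR (C • Literature.Barriers.BirchSwinnertonDyer.curve480a1.quadraticTwist (-2993)) p h5 hgood hord hirr
      hrank (max n₀ 1) (le_max_right _ _))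

/-- **`Isolation` refutes every Selmer-driven shadow principle of threshold `k ≤ 2`**:
"`corank_{ℤ_p} Sel_{p^∞}(E/ℚ) ≥ k` ⇒ an accidental zero at every depth `n ≥ 1`" is false for `k ≤ 2`, because
`corank Sel = rank + corank Ш ≥ rank` (Greenberg's identity, tree theorem
`selmerCorank_eq_mordellWeilRank_add_holds`) turns it into the rank-driven principle refuted above. The shapes
`k = 1` (`corank Ш ≥ 1`) and `k = 2` (`corank Ш ≥ 1` in even sign, by `p`-parity) are what a transported-Selmer
argument for the divisible sector of `PhantomShadow` would establish. [cite: GreenbergLNM1716, §1] -/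
theorem PhantomShadowNegative.not_selmerShadow_of_isolation (hI : IsolationOfAccidentalZeros) {k : ℕ}
    (hk : k ≤ 2) :
    ¬ ∀ (W : WeierstrassCurve ℚ) [W.IsElliptic] [W.IsGloballyMinimal] (p : ℕ) [Fact p.Prime], 5 ≤ p →
      W.HasGoodReductionAtPrime p → ¬ (p : ℤ) ∣ W.frobeniusTrace p → W.HasIrreducibleModPGaloisRep p →
      k ≤ W.selmerCorank p → ∀ n : ℕ, 1 ≤ n →
      ∃ (M : ℕ) (_ : NeZero (W.conductorNorm ℤ * M))
        (g : CuspForm (CongruenceSubgroup.Gamma0 (W.conductorNorm ℤ * M)) 2) (R : Subring ℂ)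
        (φ : R →+* ZMod (p ^ n))
        (hR : ∀ ℓ : ℕ, ℓ.Prime → ¬ ℓ ∣ W.conductorNorm ℤ * M → heckeEigenvalue g ℓ ∈ R),
        Squarefree M ∧ Nat.Coprime M (p * W.conductorNorm ℤ) ∧ IsNewform0 g ∧
        (∃ m : ℕ, (UpperHalfPlane.qExpansion 1 ⇑g).coeff m ≠ ((W.LFunction m : ℤ) : ℂ)) ∧
        cuspHeckeOperatorₗ (CongruenceSubgroup.Gamma0 (W.conductorNorm ℤ * M)) 2
          (slToGLPos ModularGroup.S * diagGL ((W.conductorNorm ℤ * M : ℕ) : ℚ) 1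
            (Nat.cast_pos.mpr (NeZero.pos (W.conductorNorm ℤ * M))) one_pos) g = -g ∧
        (∀ (ℓ : ℕ) (hℓ : ℓ.Prime) (hℓL : ¬ ℓ ∣ W.conductorNorm ℤ * M),
          φ ⟨heckeEigenvalue g ℓ, hR ℓ hℓ hℓL⟩ = ((W.frobeniusTrace ℓ : ℤ) : ZMod (p ^ n))) ∧
        ∃ Λ : ℂ → ℂ, Differentiable ℂ Λ ∧
          (∀ s : ℂ, 2 < s.re → Λ s = LSeries (fun m ↦ (UpperHalfPlane.qExpansion 1 ⇑g).coeff m) s) ∧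
          Λ 1 = 0 := by
  intro hS
  apply PhantomShadowNegative.not_rankShadow_of_isolation hI
  intro W _ _ p _ h5 hg ho hi hr n hn
  have hId : W.selmerCorank p = W.mordellWeilRank + W.shaCorank p :=
    W.selmerCorank_eq_mordellWeilRank_add_holds p
  exact hS W p h5 hg ho hi (by omega) n hn

end Summit.BirchSwinnertonDyer.BirchSwinnertonDyer.Theorems
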